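import Mathlib.NumberTheory.LSeries.ZMod
import Mathlib.NumberTheory.LSeries.Dirichlet
import Mathlib.NumberTheory.LSeries.Deriv
import Literature.NumberTheory.LFunctions.RankinEisensteinFactorisation
import Literature.NumberTheory.LFunctions.TaoLogChowlaMoebiusOfLiouville
import HarnessLib

set_option autoImplicit false

/-!
# Crux `PrintCFram.BottomClassIndexLawFiveLe` (stmt-BirchSwinnertonDyer-20372), line `eisenstein-resource-bdp-line` (registry v24):
# LEMMA D OF THE CUSP SEED, ANALYTIC CORE — the Dirichlet density of a squarefree-supported periodic weight
# (cell `bsd-print-cfram`, width seat `bsd-line-cfram-p1-w3` g13; THEOREMS ONLY, `--supports` 20372; Mathlib currency;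
# BSD is not proved by any of this)

HONEST FRAMING. General analytic number theory (no elliptic curve, no BSD): the engine of ingredient (D) «family mean
values» of the proof plan (crux notes `Lines/eisenstein-resource-bdp-line-w5g5-cusp-seed.md` §4 / §15) for the cusp conjunct
«`G = 0 ⟹ ι C = 0`» of `CuspSeed.cuspSeed_six_of_cutForm`. The family there is a set of odd negative fundamental
discriminants `d = -N` cut out by congruence and Legendre conditions on `N`, weighted by a Kronecker symbol `χ_{e* d}(n)`; as
a function of the squarefree variable `N` the weight is PERIODIC, and a prime dividing the square part kills it. This file
proves the general statement behind every such computation: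

* `tendsto_sub_one_mul_LSeries_of_periodic`: for `w : ℕ → ℂ` periodic mod `Q ≥ 1`,
  `(σ − 1) · L(w, σ) → (1/Q) Σ_{j < Q} w(j)` as `σ → 1⁺` (Mathlib's `ZMod.LFunction_residue_one`);
* `convolution_alongSquares_coprimeMoebius`: if moreover `w(g²·b) = 𝟙_{(g,M)=1}·w(b)` (`g, b ≥ 1`), then
  `sq(𝟙_{(·,M)=1}·μ) ⍟ w = 𝟙_{squarefree}·w` (Dirichlet convolution; `sq(A)(g²) = A(g)`, the tree's `alongSquares`), using the
  tree's `𝟙_{squarefree}(N) = Σ_{d² ∣ N} μ(d)` (`Literature.NumberTheory.LFunctions.sqfreeInd_eq_sum_moebius`);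
* `LSeries_squarefree_mul_eq`: hence `Σ_{N squarefree} w(N) N^{−s} = L(𝟙_{(·,M)=1}·μ, 2s) · L(w, s)` for `Re s > 1`;
* **`tendsto_sub_one_mul_LSeries_squarefree`**: `(σ − 1) · Σ_{N squarefree} w(N) N^{−σ} → L(𝟙_{(·,M)=1}·μ, 2) · (1/Q) Σ_{j < Q} w(j)`
  as `σ → 1⁺` (the Dirichlet density of the weighted squarefree set);
* `LSeries_coprime_mul_LSeries_coprimeMoebius`: `L(𝟙_{(·,M)=1}, s) · L(𝟙_{(·,M)=1}·μ, s) = 1` (`Re s > 1`; Mathlib's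
  `DirichletCharacter.LSeries.mul_mu_eq_one` for the trivial character mod `M`) — so the constant `L(𝟙_{(·,M)=1}·μ, 2) =
  Π_{ℓ ∤ M}(1 − ℓ^{−2})` CANCELS against the `f`-sum `ζ^{(M)}(2)` of the assembly (E) and no `π²` is ever needed;
* `norm_LSeries_le_of_norm_le`, `eventually_norm_sub_one_mul_LSeries_le`: the uniform bound
  `‖(σ − 1) L(w, σ)‖ ≤ 2C` on a right neighbourhood of `1` for ALL `w` with `‖w‖ ≤ C` (the domination (E) needs to exchange
  `lim_{σ→1⁺}` with the sum over `(a, b)`).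

Standard material (squarefree numbers in arithmetic progressions in Dirichlet-density form; e.g. the `s → 1⁺` shadow of
Prachar 1958 / Hooley / Tenenbaum I.3.7; the tree holds the natural-density count
`Literature.NumberTheory.QuadraticFields.abs_card_squarefree_modEq_sub_le'`, which is not used here). [folklore]

References: Mathlib `Mathlib.NumberTheory.LSeries.ZMod` (`ZMod.LFunction_residue_one`), `…LSeries.Dirichlet`
(`DirichletCharacter.LSeries.mul_mu_eq_one`), `…LSeries.Convolution`; tree `Literature.NumberTheory.LFunctions.RankinEisenstein`
(`alongSquares`, `LSeries_alongSquares`).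
-/

-- summit-side namespace `Summit.BirchSwinnertonDyer.BirchSwinnertonDyer.…` (single-conjunct summit, D-0017 layout)
set_option linter.dupNamespace false

namespace Summit.BirchSwinnertonDyer.BirchSwinnertonDyer.Theorems.PrintCFram.FamilyMean

open Filter Topology Complex LSeries ArithmeticFunction Finset
open Literature.NumberTheory.LFunctions.RankinEisenstein (alongSquares alongSquares_mul_self
  alongSquares_of_not_isSquare LSeries_alongSquares)
open scoped LSeries.notation ArithmeticFunction.Moebius

/-! ### §1. Periodic weights: `(σ − 1)·L(w, σ) → mean(w)` -/

/-- A periodic sequence is bounded: `‖w n‖ ≤ Σ_{j < Q} ‖w j‖`. [folklore] -/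
theorem norm_le_sum_of_periodic {Q : ℕ} [NeZero Q] {w : ℕ → ℂ} (hw : Function.Periodic w Q) (n : ℕ) :
    ‖w n‖ ≤ ∑ j ∈ Finset.range Q, ‖w j‖ := by
  rw [← hw.map_mod_nat n]
  exact Finset.single_le_sum (f := fun j ↦ ‖w j‖) (fun _ _ ↦ norm_nonneg _)
    (Finset.mem_range.mpr (Nat.mod_lt n (NeZero.pos Q)))

/-- `Σ_{j : ZMod Q} w(j) = Σ_{j < Q} w(j)` (`Q ≥ 1`; `ZMod Q = Fin Q`). [folklore] -/
theorem sum_zmod_val_eq_sum_range {Q : ℕ} [NeZero Q] (w : ℕ → ℂ) :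
    ∑ j : ZMod Q, w j.val = ∑ j ∈ Finset.range Q, w j := by
  obtain ⟨k, hk⟩ := Nat.exists_eq_succ_of_ne_zero (NeZero.ne Q)
  subst hk
  exact Fin.sum_univ_eq_sum_range w (k + 1)

/-- **Dirichlet density of a periodic weight.** For `w : ℕ → ℂ` periodic mod `Q ≥ 1`:
`(σ − 1) · Σ_{n ≥ 1} w(n) n^{−σ} → (1/Q) Σ_{j < Q} w(j)` as `σ → 1⁺` (the residue of the congruence `L`-function,
Mathlib `ZMod.LFunction_residue_one`, restricted to the real axis where it is the Dirichlet series). [folklore] -/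
theorem tendsto_sub_one_mul_LSeries_of_periodic {Q : ℕ} [NeZero Q] {w : ℕ → ℂ}
    (hw : Function.Periodic w Q) :
    Tendsto (fun σ : ℝ ↦ ((σ : ℂ) - 1) * LSeries w σ) (𝓝[>] 1)
      (𝓝 ((∑ j ∈ Finset.range Q, w j) / Q)) := by
  rw [← sum_zmod_val_eq_sum_range]
  set Φ : ZMod Q → ℂ := fun j ↦ w j.val with hΦ
  have hΦw : (fun n : ℕ ↦ Φ n) = w := by
    funext n
    simp only [hΦ, ZMod.val_natCast]
    exact hw.map_mod_nat n
  -- the real points `σ > 1`, cast to `ℂ`, tend to `1` within `{1}ᶜ` (cf. the tree's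
  -- `Literature.NumberTheory.BeurlingPrimes.DMV.tendsto_ofReal_nhdsGT_one`, not imported here)
  have hR : Tendsto (fun σ : ℝ ↦ (σ : ℂ)) (𝓝[>] 1) (𝓝[≠] 1) :=
    continuous_ofReal.continuousWithinAt.tendsto_nhdsWithin fun x hx ↦ by
      simp only [Set.mem_Ioi] at hx
      simp only [Set.mem_compl_iff, Set.mem_singleton_iff, ofReal_eq_one]
      exact hx.ne'
  have h1 : Tendsto (fun σ : ℝ ↦ ((σ : ℂ) - 1) * ZMod.LFunction Φ σ) (𝓝[>] 1)
      (𝓝 (∑ j, Φ j / Q)) :=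
    (ZMod.LFunction_residue_one Φ).comp hR
  rw [← Finset.sum_div] at h1
  refine h1.congr' ?_
  filter_upwards [self_mem_nhdsWithin] with σ hσ
  simp only [Set.mem_Ioi] at hσ
  rw [ZMod.LFunction_eq_LSeries Φ (by simpa using hσ), hΦw]

/-- `‖L(w, σ)‖ ≤ C · Σ_n n^{−σ}` for real `σ > 1` when `‖w n‖ ≤ C`. [folklore] -/
theorem norm_LSeries_le_of_norm_le {w : ℕ → ℂ} {C : ℝ} (hC : ∀ n, ‖w n‖ ≤ C) {σ : ℝ} (hσ : 1 < σ) :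
    ‖LSeries w σ‖ ≤ C * ∑' n : ℕ, 1 / (n : ℝ) ^ σ := by
  have hC0 : 0 ≤ C := (norm_nonneg _).trans (hC 0)
  have hsum : Summable fun n : ℕ ↦ 1 / (n : ℝ) ^ σ := Real.summable_one_div_nat_rpow.mpr hσ
  have hle : ∀ n : ℕ, ‖term w σ n‖ ≤ C * (1 / (n : ℝ) ^ σ) := by
    intro n
    rw [norm_term_eq]
    split_ifs with hn
    · exact mul_nonneg hC0 (by positivity)
    · rw [ofReal_re, one_div, ← div_eq_mul_inv]
      exact div_le_div_of_nonneg_right (hC n) (by positivity)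
  have hsw : Summable fun n : ℕ ↦ ‖term w σ n‖ :=
    (hsum.mul_left C).of_nonneg_of_le (fun _ ↦ norm_nonneg _) hle
  calc ‖LSeries w σ‖ ≤ ∑' n : ℕ, ‖term w σ n‖ := norm_tsum_le_tsum_norm hsw
    _ ≤ ∑' n : ℕ, C * (1 / (n : ℝ) ^ σ) := hsw.tsum_le_tsum hle (hsum.mul_left C)
    _ = C * ∑' n : ℕ, 1 / (n : ℝ) ^ σ := tsum_mul_left

/-- **Uniform domination near `σ = 1`.** There is a right neighbourhood of `1` on which
`‖(σ − 1) · L(w, σ)‖ ≤ 2C` for EVERY `w` with `‖w n‖ ≤ C` (from `(σ − 1)ζ(σ) → 1`, Mathlib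
`tendsto_sub_mul_tsum_nat_rpow`). [folklore] -/
theorem eventually_norm_sub_one_mul_LSeries_le (C : ℝ) :
    ∀ᶠ σ : ℝ in 𝓝[>] 1, ∀ w : ℕ → ℂ, (∀ n, ‖w n‖ ≤ C) →
      ‖((σ : ℂ) - 1) * LSeries w σ‖ ≤ 2 * C := by
  have h2 : ∀ᶠ σ : ℝ in 𝓝[>] 1, (σ - 1) * ∑' n : ℕ, 1 / (n : ℝ) ^ σ < 2 :=
    tendsto_sub_mul_tsum_nat_rpow.eventually (gt_mem_nhds (by norm_num))
  filter_upwards [h2, self_mem_nhdsWithin] with σ hσ2 hσ1 w hw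
  simp only [Set.mem_Ioi] at hσ1
  have hC0 : 0 ≤ C := (norm_nonneg _).trans (hw 0)
  rw [norm_mul, show ((σ : ℂ) - 1) = ((σ - 1 : ℝ) : ℂ) by push_cast; ring, norm_real,
    Real.norm_of_nonneg (by linarith)]
  calc (σ - 1) * ‖LSeries w σ‖ ≤ (σ - 1) * (C * ∑' n : ℕ, 1 / (n : ℝ) ^ σ) :=
        mul_le_mul_of_nonneg_left (norm_LSeries_le_of_norm_le hw hσ1) (by linarith)
    _ = C * ((σ - 1) * ∑' n : ℕ, 1 / (n : ℝ) ^ σ) := by ring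
    _ ≤ C * 2 := mul_le_mul_of_nonneg_left hσ2.le hC0
    _ = 2 * C := mul_comm _ _

/-! ### §2. The squarefree sieve: `sq(𝟙_{(·,M)=1}·μ) ⍟ w = 𝟙_{squarefree}·w` -/

/-- The square divisors of `N ≥ 1` are the `d²` with `1 ≤ d ≤ N`, `d² ∣ N`. [folklore] -/
theorem filter_isSquare_divisors_eq_image {N : ℕ} (hN : N ≠ 0) :
    N.divisors.filter IsSquare =
      ((Finset.Icc 1 N).filter (fun d ↦ d ^ 2 ∣ N)).image (fun d ↦ d ^ 2) := by
  ext a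
  simp only [Finset.mem_filter, Nat.mem_divisors, Finset.mem_image, Finset.mem_Icc]
  constructor
  · rintro ⟨⟨ha, -⟩, r, rfl⟩
    have hr : r ≠ 0 := by
      rintro rfl
      rw [mul_zero] at ha
      exact hN (zero_dvd_iff.mp ha)
    refine ⟨r, ⟨⟨Nat.pos_of_ne_zero hr, ?_⟩, by rwa [sq]⟩, sq r⟩
    exact (Nat.le_mul_self r).trans (Nat.le_of_dvd (Nat.pos_of_ne_zero hN) ha)
  · rintro ⟨d, ⟨⟨-, -⟩, hd⟩, rfl⟩
    exact ⟨⟨hd, hN⟩, ⟨d, sq d⟩⟩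

/-- `Σ_{a ∣ N} sq(f)(a) = Σ_{d ≤ N, d² ∣ N} f(d)` (`N ≥ 1`). [folklore] -/
theorem sum_divisors_alongSquares {N : ℕ} (hN : N ≠ 0) (f : ℕ → ℂ) :
    ∑ a ∈ N.divisors, alongSquares f a =
      ∑ d ∈ (Finset.Icc 1 N).filter (fun d ↦ d ^ 2 ∣ N), f d := by
  classical
  rw [← Finset.sum_filter_of_ne (p := IsSquare) (fun a _ h ↦ ?_),
    filter_isSquare_divisors_eq_image hN,
    Finset.sum_image (fun x _ y _ h ↦ (Nat.pow_left_injective two_ne_zero) h)]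
  · exact Finset.sum_congr rfl fun d _ ↦ by rw [sq, alongSquares_mul_self]
  · by_contra hs
    exact h (alongSquares_of_not_isSquare f hs)

/-- `𝟙_{squarefree}(N) = Σ_{d ≤ N, d² ∣ N} μ(d)` over `ℂ` (the tree's `sqfreeInd_eq_sum_moebius`). [folklore] -/
theorem sum_moebius_filter_sq_dvd {N : ℕ} (hN : N ≠ 0) :
    ∑ d ∈ (Finset.Icc 1 N).filter (fun d ↦ d ^ 2 ∣ N), (μ d : ℂ) =
      if Squarefree N then 1 else 0 := by
  have h := Literature.NumberTheory.LFunctions.sqfreeInd_eq_sum_moebius (Nat.pos_of_ne_zero hN) le_rfl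
  simp only [Literature.NumberTheory.LFunctions.sqfreeInd] at h
  have h' : (((∑ d ∈ (Finset.Icc 1 N).filter (fun d ↦ d ^ 2 ∣ N), (μ d : ℝ)) : ℝ) : ℂ) =
      (((if Squarefree N then 1 else 0 : ℝ)) : ℂ) := by rw [← h]
  push_cast at h'
  rw [h']
  split_ifs <;> simp

/-- **The squarefree sieve as a Dirichlet convolution.** If `w(g²·b) = 𝟙_{(g,M)=1}·w(b)` for all `g, b ≥ 1`, then
`sq(𝟙_{(·,M)=1}·μ) ⍟ w = 𝟙_{squarefree}·w`: at `N = g²b` the weight `w(N)` already carries the factor `𝟙_{(g,M)=1}`, so the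
convolution is `w(N)·Σ_{d² ∣ N, (d,M)=1} μ(d)`, and when `w(N) ≠ 0` every `d` with `d² ∣ N` is prime to `M`. [folklore] -/
theorem convolution_alongSquares_coprimeMoebius {M : ℕ} {w : ℕ → ℂ}
    (hsq : ∀ g b : ℕ, g ≠ 0 → b ≠ 0 → w (g ^ 2 * b) = if g.Coprime M then w b else 0) (N : ℕ) :
    (alongSquares (fun g ↦ if g.Coprime M then (μ g : ℂ) else 0) ⍟ w) N =
      if Squarefree N then w N else 0 := by
  classical
  rcases eq_or_ne N 0 with rfl | hN
  · simp [not_squarefree_zero]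
  set A : ℕ → ℂ := fun g ↦ if g.Coprime M then (μ g : ℂ) else 0 with hA
  rw [convolution_def]
  dsimp only
  have hterm : ∀ p ∈ N.divisorsAntidiagonal,
      alongSquares A p.1 * w p.2 = alongSquares A p.1 * w N := by
    intro p hp
    obtain ⟨hpN, -⟩ := Nat.mem_divisorsAntidiagonal.mp hp
    by_cases hs : IsSquare p.1
    · obtain ⟨g, hg⟩ := hs
      have hg0 : g ≠ 0 := by
        rintro rfl
        rw [mul_zero] at hg
        rw [hg, zero_mul] at hpN
        exact hN hpN.symm
      have hp2 : p.2 ≠ 0 := by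
        rintro h2
        rw [h2, mul_zero] at hpN
        exact hN hpN.symm
      have hwN : w N = if g.Coprime M then w p.2 else 0 := by
        rw [← hpN, hg, ← sq, hsq g p.2 hg0 hp2]
      rw [hg, alongSquares_mul_self, hwN]
      simp only [hA]
      split_ifs <;> simp
    · rw [alongSquares_of_not_isSquare A hs, zero_mul, zero_mul]
  rw [Finset.sum_congr rfl hterm, ← Finset.sum_mul,
    Nat.sum_divisorsAntidiagonal (f := fun a _ ↦ alongSquares A a), sum_divisors_alongSquares hN]
  by_cases hw : w N = 0
  · simp [hw]
  have hcop : ∀ d ∈ (Finset.Icc 1 N).filter (fun d ↦ d ^ 2 ∣ N), A d = (μ d : ℂ) := by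
    intro d hd
    simp only [Finset.mem_filter, Finset.mem_Icc] at hd
    obtain ⟨⟨hd1, -⟩, ⟨b, hb⟩⟩ := hd
    have hb0 : b ≠ 0 := by
      rintro rfl
      rw [mul_zero] at hb
      exact hN hb
    have h := hsq d b (by omega) hb0
    rw [← hb] at h
    simp only [hA]
    split_ifs with hc
    · rfl
    · exact absurd (h.trans (if_neg hc)) hw
  rw [Finset.sum_congr rfl hcop, sum_moebius_filter_sq_dvd hN]
  split_ifs <;> simp

/-! ### §3. The `L`-series factorisation and the Dirichlet density -/

/-- `|sq(𝟙_{(·,M)=1}·μ)(n)| ≤ 1`. [folklore] -/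
theorem norm_alongSquares_coprimeMoebius_le (M n : ℕ) :
    ‖alongSquares (fun g ↦ if g.Coprime M then (μ g : ℂ) else 0) n‖ ≤ 1 := by
  by_cases hs : IsSquare n
  · obtain ⟨g, rfl⟩ := hs
    rw [alongSquares_mul_self]
    split_ifs
    · rw [Complex.norm_intCast]
      exact_mod_cast abs_moebius_le_one
    · simp
  · rw [alongSquares_of_not_isSquare _ hs, norm_zero]
    exact zero_le_one

/-- `|𝟙_{(n,M)=1}·μ(n)| ≤ 1`. [folklore] -/
theorem norm_coprimeMoebius_le (M n : ℕ) :
    ‖(if n.Coprime M then (μ n : ℂ) else 0)‖ ≤ 1 := by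
  split_ifs
  · rw [Complex.norm_intCast]
    exact_mod_cast abs_moebius_le_one
  · simp

/-- **`Σ_{N squarefree} w(N) N^{−s} = L(𝟙_{(·,M)=1}·μ, 2s) · L(w, s)`** for `Re s > 1`, whenever `w` is bounded and
`w(g²·b) = 𝟙_{(g,M)=1}·w(b)` (`g, b ≥ 1`). [folklore] -/
theorem LSeries_squarefree_mul_eq {M : ℕ} {w : ℕ → ℂ} {C : ℝ} (hC : ∀ n, ‖w n‖ ≤ C)
    (hsq : ∀ g b : ℕ, g ≠ 0 → b ≠ 0 → w (g ^ 2 * b) = if g.Coprime M then w b else 0)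
    {s : ℂ} (hs : 1 < s.re) :
    LSeries (fun N ↦ if Squarefree N then w N else 0) s =
      LSeries (fun g ↦ if g.Coprime M then (μ g : ℂ) else 0) (2 * s) * LSeries w s := by
  have h1 : LSeriesSummable (alongSquares (fun g ↦ if g.Coprime M then (μ g : ℂ) else 0)) s :=
    LSeriesSummable_of_bounded_of_one_lt_re (fun n _ ↦ norm_alongSquares_coprimeMoebius_le M n) hs
  have h2 : LSeriesSummable w s := LSeriesSummable_of_bounded_of_one_lt_re (fun n _ ↦ hC n) hs
  rw [← LSeries_alongSquares, ← LSeries_convolution' h1 h2]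
  exact LSeries_congr (fun {n} _ ↦ (convolution_alongSquares_coprimeMoebius hsq n).symm) s

/-- `σ ↦ L(𝟙_{(·,M)=1}·μ, 2σ)` is continuous at `σ = 1` from the right (indeed `L(𝟙·μ, s)` is holomorphic on `Re s > 1`).
[folklore] -/
theorem tendsto_LSeries_coprimeMoebius_two_mul (M : ℕ) :
    Tendsto (fun σ : ℝ ↦ LSeries (fun g ↦ if g.Coprime M then (μ g : ℂ) else 0) (2 * (σ : ℂ)))
      (𝓝[>] 1) (𝓝 (LSeries (fun g ↦ if g.Coprime M then (μ g : ℂ) else 0) 2)) := by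
  set A : ℕ → ℂ := fun g ↦ if g.Coprime M then (μ g : ℂ) else 0 with hA
  have habs : abscissaOfAbsConv A ≤ 1 :=
    LSeries.abscissaOfAbsConv_le_of_le_const ⟨1, fun n _ ↦ norm_coprimeMoebius_le M n⟩
  have hcont : ContinuousAt (LSeries A) 2 := by
    refine (LSeries_analyticOnNhd A 2 ?_).continuousAt
    simp only [Set.mem_setOf_eq]
    refine lt_of_le_of_lt habs ?_
    rw [show (2 : ℂ).re = (2 : ℝ) by norm_num]
    exact_mod_cast (one_lt_two : (1 : ℝ) < 2)
  have h2 : Tendsto (fun σ : ℝ ↦ 2 * (σ : ℂ)) (𝓝[>] 1) (𝓝 2) := by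
    have : Tendsto (fun σ : ℝ ↦ 2 * (σ : ℂ)) (𝓝 1) (𝓝 (2 * ((1 : ℝ) : ℂ))) :=
      ((continuous_const.mul continuous_ofReal).tendsto 1)
    rw [ofReal_one, mul_one] at this
    exact this.mono_left nhdsWithin_le_nhds
  exact hcont.tendsto.comp h2

/-- **Dirichlet density of a squarefree-supported periodic weight.** Let `w : ℕ → ℂ` be periodic mod `Q ≥ 1` with
`w(g²·b) = 𝟙_{(g,M)=1}·w(b)` for all `g, b ≥ 1`. Then
`(σ − 1) · Σ_{N squarefree} w(N) N^{−σ} → L(𝟙_{(·,M)=1}·μ, 2) · (1/Q) Σ_{j < Q} w(j)` as `σ → 1⁺`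
(and `L(𝟙_{(·,M)=1}·μ, 2) = Π_{ℓ ∤ M} (1 − ℓ^{−2})`, cf. `LSeries_coprime_mul_LSeries_coprimeMoebius`). [folklore] -/
theorem tendsto_sub_one_mul_LSeries_squarefree {Q M : ℕ} [NeZero Q] {w : ℕ → ℂ}
    (hw : Function.Periodic w Q)
    (hsq : ∀ g b : ℕ, g ≠ 0 → b ≠ 0 → w (g ^ 2 * b) = if g.Coprime M then w b else 0) :
    Tendsto (fun σ : ℝ ↦ ((σ : ℂ) - 1) * LSeries (fun N ↦ if Squarefree N then w N else 0) σ)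
      (𝓝[>] 1)
      (𝓝 (LSeries (fun g ↦ if g.Coprime M then (μ g : ℂ) else 0) 2 *
        ((∑ j ∈ Finset.range Q, w j) / Q))) := by
  have hC := norm_le_sum_of_periodic hw
  have h := (tendsto_LSeries_coprimeMoebius_two_mul M).mul (tendsto_sub_one_mul_LSeries_of_periodic hw)
  refine h.congr' ?_
  filter_upwards [self_mem_nhdsWithin] with σ hσ
  simp only [Set.mem_Ioi] at hσ
  rw [LSeries_squarefree_mul_eq hC hsq (by simpa using hσ)]
  ring

/-- **The cancellation `ζ^{(M)}(s) · L(𝟙_{(·,M)=1}·μ, s) = 1`** (`Re s > 1`): the Dirichlet series of `𝟙_{(n,M)=1}` and of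
`𝟙_{(n,M)=1}·μ(n)` are inverse to each other (Mathlib's `DirichletCharacter.LSeries.mul_mu_eq_one` for the trivial character
mod `M`). In the assembly (E) this removes `π²`: the `f`-sum `Σ_{(f,M)=1} f^{−2}` times the density constant
`L(𝟙_{(·,M)=1}·μ, 2)` is `1`. [folklore] -/
theorem LSeries_coprime_mul_LSeries_coprimeMoebius (M : ℕ) {s : ℂ} (hs : 1 < s.re) :
    LSeries (fun n ↦ if n.Coprime M then (1 : ℂ) else 0) s *
      LSeries (fun n ↦ if n.Coprime M then (μ n : ℂ) else 0) s = 1 := by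
  have h := DirichletCharacter.LSeries.mul_mu_eq_one (1 : DirichletCharacter ℂ M) hs
  have h1 : ∀ n : ℕ, ((1 : DirichletCharacter ℂ M) (n : ZMod M)) = if n.Coprime M then (1 : ℂ) else 0 := by
    intro n
    by_cases hu : IsUnit (n : ZMod M)
    · rw [if_pos ((ZMod.isUnit_iff_coprime n M).mp hu)]
      obtain ⟨u, hu'⟩ := hu
      rw [← hu', MulChar.one_apply_coe]
    · rw [if_neg (fun hc ↦ hu ((ZMod.isUnit_iff_coprime n M).mpr hc)), MulChar.map_nonunit _ hu]
  have hL1 : LSeries (fun n : ℕ ↦ (1 : DirichletCharacter ℂ M) (n : ZMod M)) s =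
      LSeries (fun n ↦ if n.Coprime M then (1 : ℂ) else 0) s :=
    LSeries_congr (fun {n} _ ↦ h1 n) s
  have hL2 : LSeries ((fun n : ℕ ↦ (1 : DirichletCharacter ℂ M) (n : ZMod M)) * fun n : ℕ ↦ (μ n : ℂ)) s =
      LSeries (fun n ↦ if n.Coprime M then (μ n : ℂ) else 0) s := by
    refine LSeries_congr (fun {n} _ ↦ ?_) s
    simp only [Pi.mul_apply, h1 n]
    split_ifs <;> simp
  rw [hL1, hL2] at h
  exact h

end Summit.BirchSwinnertonDyer.BirchSwinnertonDyer.Theorems.PrintCFram.FamilyMean
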